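import Literature.Probability.Percolation.TransversalReroute
import Literature.Probability.Percolation.ArmSeparationRotate
import HarnessLib

/-!
# The six-frame protocol: rerouting all arms of one colour behind the six sides of `∂Λ_{2M}`

Topic: Probability / Percolation; family `crit-perc` (site percolation on the triangular lattice
`𝕋 = triGraph`). A brick of the generic (any-multiplicity) same-colour step of Nolin's
arm-separation theorem (Nolin 2008, Thm. 11, §4.4 [arXiv 0711.4948: Thm. 10]: "Each of the `j`
arms induces in `S_{2^{K-1},2^K}` a crossing of one of the … U-shaped regions … In a U-shaped
region, any set of disjoint crossings can be made well-separated with high probability"),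
organised after Kesten–Sidoravicius–Zhang 1998, App. §7, towards
`Literature.Probability.Percolation.Nolin2008_prop17_quasiMult` (`FiveArmExponentFacts.lean`).

The printed proofs reroute each arm inside the region of its own extremity and do not discuss
the interaction between the regions (which overlap: the trapezoid `trapD M` behind side `i` of
`∂Λ_{2M}` meets the trapezoids behind sides `i ± 1`). This file runs the single-region rerouting
of `TransversalReroute.lean` SEQUENTIALLY over the six frames `ρ^0, …, ρ^5` (`ρ = triRotIso`),
applying each step to EVERY current member (an arm already rerouted in an earlier frame that
meets a junction of a later frame is rerouted again there). Members are open `𝕋`-connected sets of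
sites of `Λ_{2M}` containing their start (a site of `Λ_M`), so that they enter every trapezoid only
through its inner side; each step preserves this shape and pairwise disjointness, fixes the
members it does not settle, and settles every member that is still an arm ending on the side
being processed. After the six steps every arm is settled in the LAST frame that touched it, on
a term of that frame's exploration sequence, whose actual tip it contains; distinct members
settled last in the same frame use distinct terms; and the reading of any other final member in
that frame is an open connected set of `Λ_{2M}` started in `Λ_M` disjoint from the rerouted
reading — the hypothesis under which the fence of the term attaches to the member and is
invaded by no other member (`TrapFenceAttach.lean`).

## Main definitions

* `frameRd i E = (ρ^i)⁻¹ E` — the reading of an actual set in frame `i` (as `rotConfig i`).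
* `FrameTransversals M χ` — a closed transversal of `rotConfig i χ` in `trapDomain M` for every
  frame `i`; `nonempty_frameTransversals`.
* `𝒯.term i E a`, `𝒯.step i E a` — the term chosen for, and the rerouting of, the actual member
  `E` (start `a`) in frame `i`; `𝒯.iter f E a` — the member after the frames `0, …, f-1`;
  `𝒯.termAt f E a`; `𝒯.lastFrame E a` (the last settled frame among `0, …, 5`); `𝒯.final E a`.
* `FrameTransversals.MemberOK M χ E a` — the invariant (open, inside `Λ_{2M}`, contains `a`,
  `𝕋`-connected from `a`).

## Main results

* `memberOK_step`, `disjoint_step`, `step_eq_self_of_term_eq_none`, `rot_tip_mem_step`,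
  `term_ne_none_of_mem_side`, `term_ne_of_disjoint` — one step.
* `memberOK_final`, `disjoint_final` — the final family is a family of the same shape, pairwise
  disjoint; `termAt_lastFrame_ne_none` — every member with a site on `∂Λ_{2M}` (every arm) is
  settled; `rot_tip_mem_final` — it contains the actual tip `ρ^f z` of its last term;
  `termAt_ne_of_disjoint` — distinct members, same last frame ⇒ distinct terms;
  `frameRd_final` — its reading in its last frame IS the rerouted reading (`τ.reroute`);
  `frameRd_final_other` — the reading of another final member there satisfies the hypotheses
  of the no-invasion theorem.

## References

* P. Nolin, *Near-critical percolation in two dimensions*, Electron. J. Probab. 13 (2008), §4.4,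
  proof of Thm. 11 and Lemma 15 [arXiv 0711.4948: Thm. 10, Lemma 14]. [Nolin2008]
* H. Kesten, V. Sidoravicius, Y. Zhang, *Almost all words are seen in critical site percolation
  on the triangular lattice*, Electron. J. Probab. 3 (1998), paper 10, App. §7 (7.9)–(7.10),
  p. 27. [KestenSidoraviciusZhang1998]
* H. Kesten, *Scaling relations for 2D-percolation*, Comm. Math. Phys. 109 (1987), Lemma 4
  ("we can modify the paths … so that their last piece coincides with one of the `r_i` … or one of
  the analogues of these for the strips `S_L`, `S_T` or `S_B`"). [Kesten1987]

Tree: `JDomain.Transversal` and its `reroute` API (`TransversalReroute.lean`), `rotConfig`,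
`triNorm_rot`, `triNorm_rot_symm`, `exists_rot_symm_apply_zero_eq`, `mem_trapO_of_apply_zero_eq`
(`ArmSeparationRotate.lean`), `pathIn_map_iso` (`TriRSWChaining.lean`), `Nat.findGreatest`.
-/

noncomputable section

namespace Literature.Probability.Percolation

open LatticeModels

open JDomain

/-! ### Transport under the frame rotations -/

section Transport

variable (φ : triGraph ≃g triGraph)

/-- Reading a set through an automorphism: `v ∈ φ⁻¹ E ↔ φ v ∈ E`. [folklore] -/
theorem mem_image_symm_iff {E : Set (Site 2)} {v : Site 2} : v ∈ φ.symm '' E ↔ φ v ∈ E := by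
  constructor
  · rintro ⟨w, hw, rfl⟩
    rwa [RelIso.apply_symm_apply]
  · intro h
    exact ⟨φ v, h, RelIso.symm_apply_apply φ v⟩

/-- `φ (φ⁻¹ E) = E`. [folklore] -/
theorem image_image_symm (E : Set (Site 2)) : φ '' (φ.symm '' E) = E := by
  ext v
  constructor
  · rintro ⟨w, hw, rfl⟩
    exact (mem_image_symm_iff φ).1 hw
  · intro hv
    exact ⟨φ.symm v, (mem_image_symm_iff φ).2 (by rwa [RelIso.apply_symm_apply]), RelIso.apply_symm_apply φ v⟩

/-- `φ⁻¹ (φ E) = E`. [folklore] -/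
theorem image_symm_image (E : Set (Site 2)) : φ.symm '' (φ '' E) = E := by
  ext v
  rw [mem_image_symm_iff]
  constructor
  · rintro ⟨w, hw, e⟩
    exact φ.injective e ▸ hw
  · intro hv
    exact ⟨v, hv, rfl⟩

/-- Disjoint sets have disjoint images. [folklore] -/
theorem disjoint_image_iso {E E' : Set (Site 2)} (h : Disjoint E E') : Disjoint (φ '' E) (φ '' E') :=
  (Set.disjoint_image_iff φ.injective).2 h

end Transport

/-! ### The frame readings -/

/-- **The reading of an actual set of sites in the frame `i`**: `(ρ^i)⁻¹ E`, so that a frame site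
`v` of the reading is the actual site `ρ^i v ∈ E` (as `rotConfig i`). [cite: Nolin2008, §4.4 (arXiv 0711.4948: proof of Thm. 10)] -/
def frameRd (i : ℕ) (E : Set (Site 2)) : Set (Site 2) := (triRotIsoPow i).symm '' E

/-- Membership in the reading. [folklore] -/
theorem mem_frameRd {i : ℕ} {E : Set (Site 2)} {v : Site 2} : v ∈ frameRd i E ↔ triRotIsoPow i v ∈ E :=
  mem_image_symm_iff _

/-- The reading of an open set is open in the rotated configuration. [folklore] -/
theorem frameRd_subset_rotConfig {i : ℕ} {E χ : Set (Site 2)} (h : E ⊆ χ) : frameRd i E ⊆ rotConfig i χ :=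
  fun _ hv => mem_rotConfig.2 (h (mem_frameRd.1 hv))

/-- The reading preserves the graph norm. [folklore] -/
theorem triNorm_le_of_mem_frameRd {i : ℕ} {E : Set (Site 2)} {K : ℤ} (h : ∀ v ∈ E, triNorm v ≤ K) {v : Site 2}
    (hv : v ∈ frameRd i E) : triNorm v ≤ K := by
  have := h _ (mem_frameRd.1 hv)
  rwa [triNorm_rot] at this

/-- The reading is `𝕋`-connected from the reading of the start. [folklore] -/
theorem pathIn_frameRd {i : ℕ} {E : Set (Site 2)} {a x : Site 2} (h : PathIn triGraph E a x) :
    PathIn triGraph (frameRd i E) ((triRotIsoPow i).symm a) ((triRotIsoPow i).symm x) :=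
  pathIn_map_iso (triRotIsoPow i).symm h

/-- Readings of disjoint sets are disjoint. [folklore] -/
theorem disjoint_frameRd {i : ℕ} {E E' : Set (Site 2)} (h : Disjoint E E') : Disjoint (frameRd i E) (frameRd i E') :=
  disjoint_image_iso _ h

/-! ### The six-step protocol -/

/-- **Transversals of the six frames**: for each frame `i`, a closed transversal of the rotated
configuration `rotConfig i χ` in the trapezoid `trapDomain M`. [cite: KestenSidoraviciusZhang1998, App. §7 (7.10) p. 27] -/
structure FrameTransversals (M : ℕ) (χ : SiteConfig (Site 2)) where
  /-- the transversal of frame `i` -/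
  τ : (i : ℕ) → (trapDomain M).Transversal (rotConfig i χ)

/-- Transversals of the six frames exist (`1 ≤ M`). [cite: KestenSidoraviciusZhang1998, App. §7 (7.10) p. 27] -/
theorem nonempty_frameTransversals {M : ℕ} (hM : 1 ≤ M) (χ : SiteConfig (Site 2)) : Nonempty (FrameTransversals M χ) :=
  ⟨⟨fun i => Classical.choice (nonempty_transversal (trapDomain_cutProp M) (trapDomain_dualProp hM) (rotConfig i χ))⟩⟩

namespace FrameTransversals

variable {M : ℕ} {χ : SiteConfig (Site 2)} (𝒯 : FrameTransversals M χ)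

/-- **The term chosen in frame `i`** for the actual member `E` with start `a` (`none` if the
reading of `E` meets no junction of frame `i`). [cite: KestenSidoraviciusZhang1998, App. §7 (7.9) p. 27] -/
def term (i : ℕ) (E : Set (Site 2)) (a : Site 2) : Option ℕ :=
  (𝒯.τ i).firstTerm (frameRd i E) ((triRotIsoPow i).symm a)

/-- **One step of the protocol**: reroute the reading of `E` in frame `i` and read back. [cite: KestenSidoraviciusZhang1998, App. §7 (7.9) p. 27] -/
def step (i : ℕ) (E : Set (Site 2)) (a : Site 2) : Set (Site 2) :=
  triRotIsoPow i '' ((𝒯.τ i).reroute (frameRd i E) ((triRotIsoPow i).symm a))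

/-- **The member after `f` steps** (frames `0, …, f - 1` processed in this order). [cite: Nolin2008, §4.4 (arXiv 0711.4948: proof of Thm. 10, "each of the j arms induces … a crossing of one of the … U-shaped regions")] -/
def iter : ℕ → Set (Site 2) → Site 2 → Set (Site 2)
  | 0, E, _ => E
  | f + 1, E, a => 𝒯.step f (iter f E a) a

/-- The reading of a step in its own frame is the rerouted reading. [folklore] -/
theorem frameRd_step (i : ℕ) (E : Set (Site 2)) (a : Site 2) :
    frameRd i (𝒯.step i E a) = (𝒯.τ i).reroute (frameRd i E) ((triRotIsoPow i).symm a) :=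
  image_symm_image _ _

/-- `iter 0 = id`. [folklore] -/
@[simp] theorem iter_zero (E : Set (Site 2)) (a : Site 2) : 𝒯.iter 0 E a = E := rfl

/-- The recursion of `iter`. [folklore] -/
theorem iter_succ (f : ℕ) (E : Set (Site 2)) (a : Site 2) : 𝒯.iter (f + 1) E a = 𝒯.step f (𝒯.iter f E a) a := rfl

/-! ### The invariant of a member -/

/-- **The invariant of a member**: open (of the colour `χ`), inside `Λ_{2M}`, containing its start,
`𝕋`-connected from it. [folklore] -/
structure MemberOK (M : ℕ) (χ E : Set (Site 2)) (a : Site 2) : Prop where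
  subset : E ⊆ χ
  norm_le : ∀ v ∈ E, triNorm v ≤ 2 * M
  start_mem : a ∈ E
  conn : ∀ x ∈ E, PathIn triGraph E a x

variable {𝒯}

section Step

variable {i : ℕ} {E E' : Set (Site 2)} {a a' : Site 2}

/-- The reading of the start is off the trapezoid (start in `Λ_M`). [folklore] -/
theorem symm_start_not_mem_D (ha : triNorm a ≤ M) : (triRotIsoPow i).symm a ∉ (trapDomain M).D :=
  not_mem_trapDomain_D_of_triNorm_le (by rwa [triNorm_rot_symm])

/-- The reading of the start is off the transversal. [folklore] -/
theorem symm_start_not_mem_T (ha : triNorm a ≤ M) : (triRotIsoPow i).symm a ∉ (𝒯.τ i).T :=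
  fun h => symm_start_not_mem_D ha (Finset.mem_coe.1 ((𝒯.τ i).T_subset h))

/-- **A step preserves the invariant.** [cite: KestenSidoraviciusZhang1998, App. §7 (7.9) p. 27] -/
theorem memberOK_step (hE : MemberOK M χ E a) (ha : triNorm a ≤ M) : MemberOK M χ (𝒯.step i E a) a := by
  have hcut := trapDomain_cutProp M
  have hrd : frameRd i E ⊆ rotConfig i χ := frameRd_subset_rotConfig hE.subset
  refine ⟨?_, ?_, ?_, ?_⟩
  · rintro _ ⟨w, hw, rfl⟩
    exact mem_rotConfig.1 (Transversal.reroute_subset_of_subset hrd hw)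
  · rintro _ ⟨w, hw, rfl⟩
    rw [triNorm_rot]
    cases h : (𝒯.τ i).firstTerm (frameRd i E) ((triRotIsoPow i).symm a) with
    | none =>
      rw [Transversal.mem_reroute_iff_of_none h] at hw
      exact triNorm_le_of_mem_frameRd hE.norm_le (Transversal.comp_subset hw)
    | some u =>
      obtain ⟨⟨⟨c, z⟩, hu⟩, -, -⟩ := Transversal.firstTerm_spec h
      rcases Transversal.reroute_subset_union h hu hw with hw | hw
      · exact triNorm_le_of_mem_frameRd hE.norm_le hw
      · exact (mem_trapD_iff_triNorm.1 ((isCrossing_of_lowestSeq hu).1.subset (Finset.mem_coe.1 hw))).2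
  · refine ⟨(triRotIsoPow i).symm a, Transversal.start_mem_reroute ?_ (symm_start_not_mem_T ha), RelIso.apply_symm_apply _ a⟩
    exact mem_frameRd.2 (by rw [RelIso.apply_symm_apply]; exact hE.start_mem)
  · rintro _ ⟨w, hw, rfl⟩
    have h := pathIn_map_iso (triRotIsoPow i) (Transversal.pathIn_reroute hcut hw)
    rwa [RelIso.apply_symm_apply] at h

/-- **A step preserves disjointness** (starts in `Λ_M`, members inside `Λ_{2M}`: the readings enter
the trapezoid only through its inner side). [cite: KestenSidoraviciusZhang1998, App. §7 (7.9) p. 27] -/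
theorem disjoint_step (hE : MemberOK M χ E a) (hE' : MemberOK M χ E' a') (ha : triNorm a ≤ M) (ha' : triNorm a' ≤ M)
    (h : Disjoint E E') : Disjoint (𝒯.step i E a) (𝒯.step i E' a') := by
  refine disjoint_image_iso _ (Transversal.disjoint_reroute (trapDomain_cutProp M) (disjoint_frameRd h)
    (symm_start_not_mem_D ha) (symm_start_not_mem_D ha') ?_ ?_)
  · exact trapDomain_entry fun v hv => triNorm_le_of_mem_frameRd hE.norm_le hv
  · exact trapDomain_entry fun v hv => triNorm_le_of_mem_frameRd hE'.norm_le hv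

/-- **An untouched member is unchanged**: if no term is chosen, the step is the identity (the
reading is open, `𝕋`-connected from a start off `T`, so it misses `T` altogether). [cite: KestenSidoraviciusZhang1998, App. §7 (7.9) p. 27] -/
theorem step_eq_self_of_term_eq_none (hE : MemberOK M χ E a) (ha : triNorm a ≤ M) (h : 𝒯.term i E a = none) :
    𝒯.step i E a = E := by
  have hrd : frameRd i E ⊆ rotConfig i χ := frameRd_subset_rotConfig hE.subset
  have hconn : ∀ x ∈ frameRd i E, PathIn triGraph (frameRd i E) ((triRotIsoPow i).symm a) x := by
    intro x hx
    have := pathIn_frameRd (i := i) (hE.conn _ (mem_frameRd.1 hx))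
    rwa [RelIso.symm_apply_apply] at this
  have hdisj : Disjoint (frameRd i E) (𝒯.τ i).T := by
    refine Set.disjoint_left.2 fun y hy hyT => ?_
    exact Transversal.firstTerm_ne_none_of_mem hrd hconn (symm_start_not_mem_T ha) hy hyT h
  rw [step, Transversal.reroute_eq_self hdisj hconn]
  exact image_image_symm _ _

/-- **A settled member reaches the tip of its term**: if the term `u` (tip `z`) is chosen in frame
`i`, the actual tip `ρ^i z` lies in the new member. [cite: KestenSidoraviciusZhang1998, App. §7 (7.9) p. 27] -/
theorem rot_tip_mem_step {u : ℕ} {c : Finset (Site 2)} {z : Site 2} (h : 𝒯.term i E a = some u)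
    (hu : (trapDomain M).lowestSeq (rotConfig i χ) u = some (c, z)) : triRotIsoPow i z ∈ 𝒯.step i E a :=
  ⟨z, Transversal.tip_mem_reroute (trapDomain_cutProp M) h hu, rfl⟩

/-- The actual junction of the chosen term is a site of the old member. [folklore] -/
theorem rot_jn_mem {u : ℕ} (h : 𝒯.term i E a = some u) : triRotIsoPow i ((𝒯.τ i).jn u) ∈ E :=
  mem_frameRd.1 (Transversal.jn_mem_of_firstTerm h)

/-- The chosen term exists. [folklore] -/
theorem exists_lowestSeq_of_term {u : ℕ} (h : 𝒯.term i E a = some u) :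
    ∃ c z, (trapDomain M).lowestSeq (rotConfig i χ) u = some (c, z) := by
  obtain ⟨⟨⟨c, z⟩, hu⟩, -, -⟩ := Transversal.firstTerm_spec h
  exact ⟨c, z, hu⟩

/-- **A member with a site on side `i` of `∂Λ_{2M}` is settled in frame `i`** (`1 ≤ M`). [cite: KestenSidoraviciusZhang1998, App. §7 p. 27] -/
theorem term_ne_none_of_mem_side (hM : 1 ≤ M) (hE : MemberOK M χ E a) (ha : triNorm a ≤ M) {y : Site 2} (hy : y ∈ E)
    (hyn : triNorm y = 2 * M) (hy0 : ((triRotIsoPow i).symm y) 0 = 2 * M) : 𝒯.term i E a ≠ none := by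
  have hrd : frameRd i E ⊆ rotConfig i χ := frameRd_subset_rotConfig hE.subset
  have hconn : ∀ x ∈ frameRd i E, PathIn triGraph (frameRd i E) ((triRotIsoPow i).symm a) x := by
    intro x hx
    have := pathIn_frameRd (i := i) (hE.conn _ (mem_frameRd.1 hx))
    rwa [RelIso.symm_apply_apply] at this
  have hyO : (triRotIsoPow i).symm y ∈ trapO M :=
    mem_trapO_of_apply_zero_eq hM (by rw [triNorm_rot_symm, hyn]) hy0
  refine Transversal.firstTerm_ne_none_of_meets_J (trapDomain_cutProp M) hrd hconn (symm_start_not_mem_D ha)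
    (trapDomain_entry fun v hv => triNorm_le_of_mem_frameRd hE.norm_le hv) ?_ hyO
  exact mem_frameRd.2 (by rwa [RelIso.apply_symm_apply])

/-- **Distinct members settled in the same frame use distinct terms.** [cite: KestenSidoraviciusZhang1998, App. §7 (7.9) p. 27] -/
theorem term_ne_of_disjoint (h : Disjoint E E') {u u' : ℕ} (hu : 𝒯.term i E a = some u) (hu' : 𝒯.term i E' a' = some u') :
    u ≠ u' :=
  Transversal.firstTerm_ne_of_disjoint (disjoint_frameRd h) hu hu'

end Step

/-! ### Iterating over the six frames -/

section Iter

variable {E E' : Set (Site 2)} {a a' : Site 2}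

/-- The invariant along the protocol. [folklore] -/
theorem memberOK_iter (hE : MemberOK M χ E a) (ha : triNorm a ≤ M) : ∀ f, MemberOK M χ (𝒯.iter f E a) a
  | 0 => hE
  | f + 1 => memberOK_step (memberOK_iter hE ha f) ha

/-- **Disjointness along the protocol.** [cite: KestenSidoraviciusZhang1998, App. §7 (7.9) p. 27] -/
theorem disjoint_iter (hE : MemberOK M χ E a) (hE' : MemberOK M χ E' a') (ha : triNorm a ≤ M) (ha' : triNorm a' ≤ M)
    (h : Disjoint E E') : ∀ f, Disjoint (𝒯.iter f E a) (𝒯.iter f E' a')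
  | 0 => h
  | f + 1 => disjoint_step (memberOK_iter hE ha f) (memberOK_iter hE' ha' f) ha ha' (disjoint_iter hE hE' ha ha' h f)

/-- The term chosen at step `f` of the protocol. [folklore] -/
def termAt (𝒯 : FrameTransversals M χ) (f : ℕ) (E : Set (Site 2)) (a : Site 2) : Option ℕ := 𝒯.term f (𝒯.iter f E a) a

/-- Untouched steps do not change the member. [folklore] -/
theorem iter_succ_eq_of_termAt_eq_none (hE : MemberOK M χ E a) (ha : triNorm a ≤ M) {f : ℕ} (h : 𝒯.termAt f E a = none) :
    𝒯.iter (f + 1) E a = 𝒯.iter f E a :=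
  step_eq_self_of_term_eq_none (memberOK_iter hE ha f) ha h

/-- A run of untouched steps does not change the member. [folklore] -/
theorem iter_eq_of_forall_none (hE : MemberOK M χ E a) (ha : triNorm a ≤ M) {f g : ℕ} (hfg : f ≤ g)
    (h : ∀ m, f ≤ m → m < g → 𝒯.termAt m E a = none) : 𝒯.iter g E a = 𝒯.iter f E a := by
  induction hfg with
  | refl => rfl
  | @step g hfg ih =>
    rw [iter_succ_eq_of_termAt_eq_none hE ha (h g hfg (Nat.lt_succ_self g))]
    exact ih fun m hm hmg => h m hm (Nat.lt_succ_of_lt hmg)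

open Classical in
/-- **The last frame in which the member was settled** (among the frames `0, …, 5`; `0` if none). [cite: Nolin2008, §4.4 (arXiv 0711.4948: proof of Thm. 10)] -/
def lastFrame (𝒯 : FrameTransversals M χ) (E : Set (Site 2)) (a : Site 2) : ℕ :=
  Nat.findGreatest (fun f => 𝒯.termAt f E a ≠ none) 5

/-- `lastFrame ≤ 5`. [folklore] -/
theorem lastFrame_le (E : Set (Site 2)) (a : Site 2) : 𝒯.lastFrame E a ≤ 5 := by
  classical
  exact Nat.findGreatest_le 5

/-- After the last settled frame, the member is untouched. [folklore] -/
theorem termAt_eq_none_of_lastFrame_lt {f : ℕ} (hf : 𝒯.lastFrame E a < f) (hf5 : f ≤ 5) : 𝒯.termAt f E a = none := by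
  classical
  by_contra h
  exact Nat.findGreatest_is_greatest hf hf5 h

/-- **The final member** (after the six frames). [cite: Nolin2008, §4.4 (arXiv 0711.4948: proof of Thm. 10)] -/
def final (𝒯 : FrameTransversals M χ) (E : Set (Site 2)) (a : Site 2) : Set (Site 2) := 𝒯.iter 6 E a

/-- The final member is the member right after its last settled frame. [folklore] -/
theorem final_eq_iter_lastFrame_succ (hE : MemberOK M χ E a) (ha : triNorm a ≤ M) :
    𝒯.final E a = 𝒯.iter (𝒯.lastFrame E a + 1) E a := by
  refine iter_eq_of_forall_none hE ha (Nat.succ_le_of_lt (Nat.lt_of_le_of_lt (lastFrame_le E a) (by norm_num))) ?_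
  intro m hm hm6
  exact termAt_eq_none_of_lastFrame_lt (Nat.lt_of_succ_le hm) (by omega)

/-- **The reading of the final member in its last frame is the rerouted reading of the member at
that step** — the shape to which the fence-attachment and no-invasion theorems apply. [cite: KestenSidoraviciusZhang1998, App. §7 (7.9) p. 27] -/
theorem frameRd_final (hE : MemberOK M χ E a) (ha : triNorm a ≤ M) :
    frameRd (𝒯.lastFrame E a) (𝒯.final E a) =
      (𝒯.τ (𝒯.lastFrame E a)).reroute (frameRd (𝒯.lastFrame E a) (𝒯.iter (𝒯.lastFrame E a) E a))
        ((triRotIsoPow (𝒯.lastFrame E a)).symm a) := by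
  rw [final_eq_iter_lastFrame_succ hE ha, iter_succ, frameRd_step]

/-- The final member satisfies the invariant. [folklore] -/
theorem memberOK_final (hE : MemberOK M χ E a) (ha : triNorm a ≤ M) : MemberOK M χ (𝒯.final E a) a :=
  memberOK_iter hE ha 6

/-- **Final members of disjoint members are disjoint.** [cite: KestenSidoraviciusZhang1998, App. §7 (7.9) p. 27] -/
theorem disjoint_final (hE : MemberOK M χ E a) (hE' : MemberOK M χ E' a') (ha : triNorm a ≤ M) (ha' : triNorm a' ≤ M)
    (h : Disjoint E E') : Disjoint (𝒯.final E a) (𝒯.final E' a') :=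
  disjoint_iter hE hE' ha ha' h 6

/-- **Every member with a site on `∂Λ_{2M}` is settled in some frame** (`1 ≤ M`): if no step settled
it, it would be unchanged when the frame of that boundary site is processed, and settled there. [cite: Nolin2008, §4.4 (arXiv 0711.4948: proof of Thm. 10)] -/
theorem termAt_lastFrame_ne_none (hM : 1 ≤ M) (hE : MemberOK M χ E a) (ha : triNorm a ≤ M) {y : Site 2} (hy : y ∈ E)
    (hyn : triNorm y = 2 * M) : 𝒯.termAt (𝒯.lastFrame E a) E a ≠ none := by
  classical
  obtain ⟨i, hi6, hi0⟩ := exists_rot_symm_apply_zero_eq y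
  -- some frame `≤ 5` settles the member
  have hex : ∃ f, f ≤ 5 ∧ 𝒯.termAt f E a ≠ none := by
    by_contra hnone
    push Not at hnone
    have hiter : 𝒯.iter i E a = E :=
      iter_eq_of_forall_none hE ha (Nat.zero_le i) fun m _ hmi => hnone m (by omega)
    have h := term_ne_none_of_mem_side (𝒯 := 𝒯) (i := i) hM hE ha hy hyn (by rw [hi0, hyn])
    exact h (hiter ▸ hnone i (by omega))
  obtain ⟨f, hf5, hf⟩ := hex
  exact Nat.findGreatest_spec (P := fun f => 𝒯.termAt f E a ≠ none) hf5 hf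

/-- **Distinct members settled last in the same frame use distinct terms there.** [cite: KestenSidoraviciusZhang1998, App. §7 (7.9) p. 27] -/
theorem termAt_ne_of_disjoint (hE : MemberOK M χ E a) (hE' : MemberOK M χ E' a') (ha : triNorm a ≤ M) (ha' : triNorm a' ≤ M)
    (h : Disjoint E E') {f u u' : ℕ} (hu : 𝒯.termAt f E a = some u) (hu' : 𝒯.termAt f E' a' = some u') : u ≠ u' :=
  term_ne_of_disjoint (disjoint_iter hE hE' ha ha' h f) hu hu'

/-- **The final member reaches the actual tip of its last term.** [cite: KestenSidoraviciusZhang1998, App. §7 (7.9) p. 27] -/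
theorem rot_tip_mem_final (hE : MemberOK M χ E a) (ha : triNorm a ≤ M) {u : ℕ} {c : Finset (Site 2)} {z : Site 2}
    (hu : 𝒯.termAt (𝒯.lastFrame E a) E a = some u)
    (hcz : (trapDomain M).lowestSeq (rotConfig (𝒯.lastFrame E a) χ) u = some (c, z)) :
    triRotIsoPow (𝒯.lastFrame E a) z ∈ 𝒯.final E a := by
  rw [final_eq_iter_lastFrame_succ hE ha, iter_succ]
  exact rot_tip_mem_step hu hcz

/-- **The reading of another final member in the last frame of a member**: open, inside `Λ_{2M}`,
`𝕋`-connected from the reading of its start, and disjoint from the rerouted reading — the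
hypotheses of the no-invasion theorem `JDomain.Transversal.not_mem_of_mem_termFence`. [cite: KestenSidoraviciusZhang1998, App. §7 (7.9) p. 27] -/
theorem frameRd_final_other (hE : MemberOK M χ E a) (hE' : MemberOK M χ E' a') (ha : triNorm a ≤ M) (ha' : triNorm a' ≤ M)
    (h : Disjoint E E') :
    frameRd (𝒯.lastFrame E a) (𝒯.final E' a') ⊆ rotConfig (𝒯.lastFrame E a) χ ∧
      (∀ v ∈ frameRd (𝒯.lastFrame E a) (𝒯.final E' a'), triNorm v ≤ 2 * M) ∧
      triNorm ((triRotIsoPow (𝒯.lastFrame E a)).symm a') ≤ M ∧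
      (∀ x ∈ frameRd (𝒯.lastFrame E a) (𝒯.final E' a'),
        PathIn triGraph (frameRd (𝒯.lastFrame E a) (𝒯.final E' a')) ((triRotIsoPow (𝒯.lastFrame E a)).symm a') x) ∧
      Disjoint (frameRd (𝒯.lastFrame E a) (𝒯.final E' a'))
        ((𝒯.τ (𝒯.lastFrame E a)).reroute (frameRd (𝒯.lastFrame E a) (𝒯.iter (𝒯.lastFrame E a) E a))
          ((triRotIsoPow (𝒯.lastFrame E a)).symm a)) := by
  have hF' := memberOK_final (𝒯 := 𝒯) hE' ha'
  refine ⟨frameRd_subset_rotConfig hF'.subset, fun v hv => triNorm_le_of_mem_frameRd hF'.norm_le hv,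
    by rwa [triNorm_rot_symm], fun x hx => ?_, ?_⟩
  · have := pathIn_frameRd (i := 𝒯.lastFrame E a) (hF'.conn _ (mem_frameRd.1 hx))
    rwa [RelIso.symm_apply_apply] at this
  · rw [← frameRd_final hE ha]
    exact (disjoint_frameRd (disjoint_final hE hE' ha ha' h)).symm

end Iter

end FrameTransversals

end Literature.Probability.Percolation
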